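/-
COR-CM (cell pub-hodgecm2, stage 2 of the Hodge ladder) — count-neutral KERNEL COMBINATORICS «the sheared dihedral family», part I: the datum
(seat prover-pub-hodgecm2-b23-g52-0, binder prover b23, gen 52; claim «SYLOW TRANSFER XII + THE SHEARED DIHEDRAL FAMILY», HOME/INBOX.md l.23708).
One structure (`Datum`) + theorems, on top of seat b09ʼs intrinsic model (`CMF G c`, `Block`, `fibreTwo` …, consumed BY NAME in the sequels);
no `decide`, no certificate, no named fact, no `sorry`; `Interfaces.lean` (C1), every E term, B01, `Transposition/*`, `PortJoin/*`, `D2Bridge/*`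
untouched.  HONEST FRAMING: `HC_CM` is NOT proved, here or anywhere in the tree; nothing here is a period, a count of record or a headline.
T5: n/a-class (hypothesis binders = the fields of `ShearedDihedral.Datum`; inhabited by the Pauli group `D₄ ∘ ℤ/4` (n = 2), by
`X_p = ℤ/p ⋊ D₄` with Klein kernel (n = p odd), by `(ℤ/8 × ℤ/2) ⋊ (−a+4b, b)` (n = 4); checker: self).
-/
import Summits.HodgeConjecture.CorCM.Census.DihedralDatum
import Summits.HodgeConjecture.CorCM.Census.IndexTwoCyclicNormalForm

/-!
# The sheared dihedral family, I: the datum `G_n = ⟨g, s, x | g²ⁿ = s² = x² = 1, gs = sg, xgx = g⁻¹, xsx = gⁿs⟩`, `c = gⁿ`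

After seat b09ʼs commutator law (`μ(G,c) = φ₂(G,c)` whenever `c ∉ [G,G]`) the open face census is the world `c ∈ [G,G]`.  Its smallest open rows of
order `8·odd` are `X_p = ℤ/p ⋊ D₄` with KLEIN kernel (`c = r²`; gen 51ʼs `SYLOW-TRANSFER.md` §3) — and `X_p` is the odd member of ONE family:

  `G_n = ⟨g, s, x | g²ⁿ = 1, s² = 1, x² = 1, gs = sg, x g x = g⁻¹, x s x = gⁿ s⟩`, `c := gⁿ`, `|G_n| = 8n` (`n ≥ 1`).

`G_n ⊃ ⟨g, x⟩ ≅ D(ℤ/2n)` (dihedral of order `4n`, `c` its central rotation) with `s` acting as the SHEAR «reflections `ρ ↦ cρ`, rotations fixed»;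
`G_n ⊃ ⟨g, s⟩ ≅ ℤ/2n × ℤ/2` (abelian) with the involution `x` acting by `(a, b) ↦ (−a + nb, b)`; `G_n ⊃ ⟨g, sx⟩ ≅ Dic_n`.  Members: `G_1 = D₄`;
`G_2 = D₄ ∘ ℤ/4` (the Pauli group, an open degree-16 row); `G_p = X_p` (`p` odd: `z = g²`-part, `r = sx`, Klein kernel `{1, c, s, cs}`); `G_4 =
(ℤ/8 × ℤ/2) ⋊ (−a+4b, b)` (gen 46ʼs order-32 atlas: `μ = φ₂ = 2126`); for `n` even `G_n = D(ℤ/2n) ∘ ℤ/4`.  Always `c ∈ [G,G]` (`c = [x, g^{?}]…`; no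
cyclic character).  NUMERICS (this seatʼs `work/tools46/shear*.py`): `β = 22, 194, 2128`, `φ₂ = 20, 192, 2126 = β − 2` for `n = 2, 3, 4`, and gen 46ʼs
split checklist realises `μ = φ₂` over each of the three cores for `n = 2, 3` (over the dihedral core ALL closing faces sit at the base diagonal type).
CONJECTURE (the SHEARED DIHEDRAL LAW): `μ(G_n, gⁿ) = β − 2 = φ₂` for every `n ≥ 1`.

THIS FILE: the structure `Datum` (§1), the relations (§2: `x gⁱ = g⁻ⁱ x`, `x s = c s x`, `(gⁱx)² = 1`, `(gⁱ s x)² = c`, `c` central of order two),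
the NORMAL FORM `gⁱ sʲ xᵉ` (§3: `normalForm_injective`, **`exhaust`**, `card_eq_eight_mul`).  Part II (`Census/ShearedDihedralFloor.lean`):
`𝒦(G,c) = G`, `β = φ₂ + 2`, the floor `μ ≥ β − 2`.

## References
* [Pohlmann1968] H. Pohlmann, Algebraic cycles on abelian varieties of complex multiplication type, Ann. of Math. 88 (1968), Thm 1.
* [Milne1999] J. S. Milne, Lefschetz motives and the Tate conjecture, Compositio Math. 117 (1999), Prop. 2.1, p. 54.
-/

namespace Summit.HodgeConjecture.CorCM.Census.ShearedDihedral

open Finset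

noncomputable section

variable {G : Type*} [Group G] [Fintype G] [DecidableEq G] {c : G} {n : ℕ}

/-! ## §1 The sheared dihedral datum -/

/-- **A sheared dihedral datum for `(G, c)` at level `n`**: commuting `g` (order `2n`, `gⁿ = c`) and an involution `s ∉ ⟨g⟩`, and an involution `x`
outside `⟨g, s⟩` inverting `g` and shearing `s` (`x s x = gⁿ s`), in a group of order `8n`.  Then `G ≅ G_n`. [folklore] -/
structure Datum (G : Type*) [Group G] (c : G) (n : ℕ) where
  /-- the rotation -/
  g : G
  /-- the central-type involution commuting with `g` -/
  s : G
  /-- the reflection -/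
  x : G
  /-- `gⁿ = c` -/
  hgn : g ^ n = c
  /-- `g` has order `2n` -/
  hord : orderOf g = 2 * n
  /-- `s` is an involution -/
  hs2 : s * s = 1
  /-- `g` and `s` commute -/
  hgs : g * s = s * g
  /-- `s` is not a power of `g` -/
  hs : s ∉ Subgroup.zpowers g
  /-- `x` is an involution -/
  hx2 : x * x = 1
  /-- `x` inverts `g` -/
  hxg : x * g * x⁻¹ = g⁻¹
  /-- `x` shears `s`: `x s x⁻¹ = gⁿ s = c s` -/
  hxs : x * s * x⁻¹ = g ^ n * s
  /-- `x` is not of the form `gⁱ sʲ` -/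
  hx : ∀ i j : ℕ, x ≠ g ^ i * s ^ j
  /-- `|G| = 8n` -/
  hcard : Nat.card G = 8 * n

variable (D : Datum G c n)

namespace Datum

include D

/-! ## §2 Relations -/

omit [Fintype G] [DecidableEq G] in
/-- `s⁻¹ = s`. [folklore] -/
private theorem s_inv : D.s⁻¹ = D.s := inv_eq_of_mul_eq_one_right D.hs2

omit [Fintype G] [DecidableEq G] in
/-- `x⁻¹ = x`. [folklore] -/
private theorem x_inv : D.x⁻¹ = D.x := inv_eq_of_mul_eq_one_right D.hx2

omit [Fintype G] [DecidableEq G] in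
/-- `sʲ = s^{j % 2}`. [folklore] -/
theorem s_pow_eq_pow_mod (j : ℕ) : D.s ^ j = D.s ^ (j % 2) := by
  conv_lhs => rw [← Nat.div_add_mod j 2, pow_add, pow_mul, pow_two, D.hs2, one_pow, one_mul]

omit [Fintype G] [DecidableEq G] in
/-- `g` and `s` commute. [folklore] -/
theorem commute_g_s : Commute D.g D.s := D.hgs

omit [Fintype G] [DecidableEq G] in
/-- `gⁱ sʲ = sʲ gⁱ`. [folklore] -/
theorem pow_mul_spow (i j : ℕ) : D.g ^ i * D.s ^ j = D.s ^ j * D.g ^ i := (D.commute_g_s.pow_pow i j).eq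

omit [DecidableEq G] in
/-- `g` has positive order, so `n ≥ 1`. [folklore] -/
private theorem one_le : 1 ≤ n := by
  have h := D.hord
  have hpos : 0 < orderOf D.g := orderOf_pos D.g
  omega

omit [Fintype G] [DecidableEq G] in
/-- `g^{2n} = 1`. [folklore] -/
private theorem pow_two_mul : D.g ^ (2 * n) = 1 := by rw [← D.hord]; exact pow_orderOf_eq_one D.g

omit [Fintype G] [DecidableEq G] in
/-- `c·c = 1`. [folklore] -/
theorem c_mul_c : c * c = 1 := by
  have h : D.g ^ n * D.g ^ n = 1 := by rw [← pow_add, ← two_mul]; exact D.pow_two_mul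
  rwa [D.hgn] at h

omit [Fintype G] [DecidableEq G] in
/-- `c⁻¹ = c`. [folklore] -/
private theorem c_inv : c⁻¹ = c := inv_eq_of_mul_eq_one_right D.c_mul_c

omit [DecidableEq G] in
/-- `c ≠ 1` (`g` has order `2n > n`). [folklore] -/
theorem c_ne_one : c ≠ 1 := by
  intro h
  have h1 : D.g ^ n = 1 := by rw [D.hgn, h]
  have hdvd := orderOf_dvd_of_pow_eq_one h1
  rw [D.hord] at hdvd
  have := Nat.le_of_dvd (by have := D.one_le; omega) hdvd
  have := D.one_le
  omega

omit [DecidableEq G] in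
/-- The inverse of a power of `g` as a power: `(gᵏ)⁻¹ = g^{k(2n−1)}`. [folklore] -/
private theorem inv_pow_eq (k : ℕ) : (D.g ^ k)⁻¹ = D.g ^ (k * (2 * n - 1)) := by
  apply inv_eq_of_mul_eq_one_right
  rw [← pow_add]
  have e : k + k * (2 * n - 1) = (2 * n) * k := by
    have := D.one_le
    zify [show 1 ≤ 2 * n by omega]
    ring
  rw [e, pow_mul, D.pow_two_mul, one_pow]

omit [Fintype G] [DecidableEq G] in
/-- `x g = g⁻¹ x`. [folklore] -/
theorem x_mul_g : D.x * D.g = D.g⁻¹ * D.x := by rw [← D.hxg, inv_mul_cancel_right]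

omit [Fintype G] [DecidableEq G] in
/-- `x gⁱ x⁻¹ = (gⁱ)⁻¹`. [folklore] -/
theorem x_mul_pow_mul_xinv (i : ℕ) : D.x * D.g ^ i * D.x⁻¹ = (D.g ^ i)⁻¹ := by
  rw [← MulAut.conj_apply, map_pow, MulAut.conj_apply, D.hxg, inv_pow]

omit [Fintype G] [DecidableEq G] in
/-- `x gⁱ = (gⁱ)⁻¹ x`. [folklore] -/
theorem x_mul_pow (i : ℕ) : D.x * D.g ^ i = (D.g ^ i)⁻¹ * D.x := by rw [← D.x_mul_pow_mul_xinv i, inv_mul_cancel_right]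

omit [Fintype G] [DecidableEq G] in
/-- `gⁱ x = x (gⁱ)⁻¹`. [folklore] -/
theorem pow_mul_x (i : ℕ) : D.g ^ i * D.x = D.x * (D.g ^ i)⁻¹ := by
  have h2 : D.x * (D.g ^ i)⁻¹ * D.x⁻¹ = D.g ^ i := by
    rw [← MulAut.conj_apply, map_inv, MulAut.conj_apply, D.x_mul_pow_mul_xinv, inv_inv]
  calc D.g ^ i * D.x = D.x * (D.g ^ i)⁻¹ * D.x⁻¹ * D.x := by rw [h2]
    _ = D.x * (D.g ^ i)⁻¹ := by rw [inv_mul_cancel_right]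

omit [Fintype G] [DecidableEq G] in
/-- **The shear**: `x s = c s x`. [folklore] -/
theorem x_mul_s : D.x * D.s = c * D.s * D.x := by
  have h := D.hxs
  rw [D.hgn] at h
  calc D.x * D.s = D.x * D.s * D.x⁻¹ * D.x := by rw [inv_mul_cancel_right]
    _ = c * D.s * D.x := by rw [h]

omit [Fintype G] [DecidableEq G] in
/-- `x c = c x` (`x` inverts `gⁿ = c = c⁻¹`). [folklore] -/
theorem x_mul_c : Commute D.x c := by
  have h := D.x_mul_pow n
  rw [D.hgn, D.c_inv] at h
  exact h

omit [Fintype G] [DecidableEq G] in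
/-- `g c = c g`. [folklore] -/
theorem g_mul_c : Commute D.g c := by
  have h : D.g * D.g ^ n = D.g ^ n * D.g := by rw [← pow_succ, ← pow_succ']
  rw [D.hgn] at h
  exact h

omit [Fintype G] [DecidableEq G] in
/-- `s c = c s`. [folklore] -/
theorem s_mul_c : Commute D.s c := by
  have h := D.pow_mul_spow n 1
  rw [pow_one, D.hgn] at h
  exact h.symm

omit [Fintype G] [DecidableEq G] in
/-- **`(gⁱ x)² = 1`**: the elements `gⁱ x` are involutions. [folklore] -/
theorem pow_mul_x_mul_self (i : ℕ) : D.g ^ i * D.x * (D.g ^ i * D.x) = 1 := by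
  rw [mul_assoc, ← mul_assoc D.x, D.x_mul_pow, mul_assoc, ← mul_assoc, mul_inv_cancel, one_mul, D.hx2]

omit [Fintype G] [DecidableEq G] in
/-- **`(gⁱ s x)² = c`**: the elements `gⁱ s x` have square `c`. [folklore] -/
theorem pow_mul_s_mul_x_mul_self (i : ℕ) : D.g ^ i * D.s * D.x * (D.g ^ i * D.s * D.x) = c := by
  have h1 := D.x_mul_pow i
  have h2 := D.x_mul_s
  calc D.g ^ i * D.s * D.x * (D.g ^ i * D.s * D.x) = D.g ^ i * D.s * ((D.x * D.g ^ i) * D.s * D.x) := by simp only [mul_assoc]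
    _ = D.g ^ i * D.s * ((D.g ^ i)⁻¹ * (D.x * D.s) * D.x) := by rw [h1]; simp only [mul_assoc]
    _ = D.g ^ i * D.s * (D.g ^ i)⁻¹ * c * D.s * (D.x * D.x) := by rw [h2]; simp only [mul_assoc]
    _ = D.s * c * D.s := by rw [D.hx2, mul_one, (D.commute_g_s.pow_left i).eq, mul_inv_cancel_right]
    _ = c := by rw [D.s_mul_c.eq, mul_assoc, D.hs2, mul_one]

/-! ## §3 The normal form `gⁱ sʲ xᵉ` -/

omit [DecidableEq G] in
/-- `x` is not in the abelian part: `gⁱ sʲ x ≠ gⁱ' sʲ'`. [folklore] -/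
theorem pow_spow_x_ne (i j i' j' : ℕ) : D.g ^ i * D.s ^ j * D.x ≠ D.g ^ i' * D.s ^ j' := by
  intro h
  apply D.hx (i * (2 * n - 1) + i') (j + j')
  calc D.x = (D.g ^ i * D.s ^ j)⁻¹ * (D.g ^ i' * D.s ^ j') := by rw [← h, inv_mul_cancel_left]
    _ = D.s ^ j * D.g ^ (i * (2 * n - 1)) * (D.g ^ i' * D.s ^ j') := by
        rw [mul_inv_rev, D.inv_pow_eq, ← inv_pow, D.s_inv]
    _ = D.g ^ (i * (2 * n - 1)) * (D.s ^ j * D.g ^ i') * D.s ^ j' := by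
        rw [← D.pow_mul_spow (i * (2 * n - 1)) j]; simp only [mul_assoc]
    _ = D.g ^ (i * (2 * n - 1)) * (D.g ^ i' * D.s ^ j) * D.s ^ j' := by rw [D.pow_mul_spow i' j]
    _ = D.g ^ (i * (2 * n - 1) + i') * D.s ^ (j + j') := by rw [pow_add, pow_add]; simp only [mul_assoc]

omit [Fintype G] [DecidableEq G] in
/-- Normal forms inside the abelian part are unique: `gⁱ sʲ = gⁱ' sʲ'` (`i, i' < 2n`, `j, j' < 2`) forces `i = i'`, `j = j'`. [folklore] -/
theorem pow_spow_inj {i j i' j' : ℕ} (hi : i < 2 * n) (hi' : i' < 2 * n) (hj : j < 2) (hj' : j' < 2)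
    (h : D.g ^ i * D.s ^ j = D.g ^ i' * D.s ^ j') : i = i' ∧ j = j' := by
  have hjj : j = j' := by
    by_contra hne
    -- then `s` is a power of `g`
    have key : ∀ {a b : ℕ}, D.g ^ a * D.s = D.g ^ b → False := fun {a b} hab =>
      D.hs (by
        have : D.s = (D.g ^ a)⁻¹ * D.g ^ b := by rw [← hab, inv_mul_cancel_left]
        rw [this]
        exact mul_mem (inv_mem (Subgroup.pow_mem _ (Subgroup.mem_zpowers _) _)) (Subgroup.pow_mem _ (Subgroup.mem_zpowers _) _))
    interval_cases j <;> interval_cases j'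
    · exact hne rfl
    · rw [pow_zero, mul_one, pow_one] at h; exact key h.symm
    · rw [pow_zero, mul_one, pow_one] at h; exact key h
    · exact hne rfl
  subst hjj
  refine ⟨?_, rfl⟩
  have h' : D.g ^ i = D.g ^ i' := mul_right_cancel h
  have := pow_inj_mod.mp h'
  rwa [D.hord, Nat.mod_eq_of_lt hi, Nat.mod_eq_of_lt hi'] at this

omit [DecidableEq G] in
/-- **The normal form is injective**: `gⁱ sʲ xᵉ` (`i < 2n`, `j, e < 2`) are pairwise distinct. [folklore] -/
theorem normalForm_inj {i j e i' j' e' : ℕ} (hi : i < 2 * n) (hi' : i' < 2 * n) (hj : j < 2) (hj' : j' < 2) (he : e < 2) (he' : e' < 2)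
    (h : D.g ^ i * D.s ^ j * D.x ^ e = D.g ^ i' * D.s ^ j' * D.x ^ e') : i = i' ∧ j = j' ∧ e = e' := by
  have hee : e = e' := by
    by_contra hne
    interval_cases e <;> interval_cases e'
    · exact hne rfl
    · rw [pow_zero, mul_one, pow_one] at h; exact D.pow_spow_x_ne i' j' i j h.symm
    · rw [pow_zero, mul_one, pow_one] at h; exact D.pow_spow_x_ne i j i' j' h
    · exact hne rfl
  subst hee
  obtain ⟨h1, h2⟩ := D.pow_spow_inj hi hi' hj hj' (mul_right_cancel h)
  exact ⟨h1, h2, rfl⟩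

omit [DecidableEq G] in
/-- **`|G| = 8n`** as a `Fintype.card`. [folklore] -/
theorem card_eq_eight_mul : Fintype.card G = 8 * n := by rw [← Nat.card_eq_fintype_card, D.hcard]

omit [DecidableEq G] in
/-- **EXHAUSTION: every element is `gⁱ sʲ xᵉ`** with `i < 2n`, `j < 2`, `e < 2` (the `8n` normal forms are distinct in a group of order `8n`).
[folklore] -/
theorem exhaust (y : G) : ∃ i : ℕ, i < 2 * n ∧ ∃ j : ℕ, j < 2 ∧ ∃ e : ℕ, e < 2 ∧ y = D.g ^ i * D.s ^ j * D.x ^ e := by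
  classical
  let f : Fin (2 * n) × Fin 2 × Fin 2 → G := fun t => D.g ^ (t.1 : ℕ) * D.s ^ (t.2.1 : ℕ) * D.x ^ (t.2.2 : ℕ)
  have hinj : Function.Injective f := by
    rintro ⟨i, j, e⟩ ⟨i', j', e'⟩ h
    obtain ⟨h1, h2, h3⟩ := D.normalForm_inj i.2 i'.2 j.2 j'.2 e.2 e'.2 h
    ext <;> simp only [h1, h2, h3]
  have hcard : Fintype.card (Fin (2 * n) × Fin 2 × Fin 2) = Fintype.card G := by
    rw [D.card_eq_eight_mul]; simp only [Fintype.card_prod, Fintype.card_fin]; ring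
  have hbij : Function.Bijective f := (Fintype.bijective_iff_injective_and_card f).mpr ⟨hinj, hcard⟩
  obtain ⟨⟨i, j, e⟩, rfl⟩ := hbij.2 y
  exact ⟨i, i.2, j, j.2, e, e.2, rfl⟩

omit [DecidableEq G] in
/-- **`c` is central.** [folklore] -/
theorem hcen : ∀ y : G, y * c = c * y := by
  intro y
  obtain ⟨i, -, j, -, e, -, rfl⟩ := D.exhaust y
  exact (((D.g_mul_c.pow_left i).mul_left (D.s_mul_c.pow_left j)).mul_left (D.x_mul_c.pow_left e)).eq

omit [DecidableEq G] in
/-- `x ∉ ⟨g⟩`. [folklore] -/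
theorem x_notMem_zpowers_g : D.x ∉ Subgroup.zpowers D.g := by
  intro h
  obtain ⟨i, -, hi⟩ := IndexTwoCyclic.exists_pow_eq_of_mem_zpowers h
  exact D.hx i 0 (by rw [pow_zero, mul_one, hi])

omit [DecidableEq G] in
/-- `s x ∉ ⟨g⟩`. [folklore] -/
theorem s_mul_x_notMem_zpowers_g : D.s * D.x ∉ Subgroup.zpowers D.g := by
  intro h
  obtain ⟨i, -, hi⟩ := IndexTwoCyclic.exists_pow_eq_of_mem_zpowers h
  refine D.hx i 1 ?_
  rw [pow_one]
  calc D.x = D.s * (D.s * D.x) := by rw [← mul_assoc, D.hs2, one_mul]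
    _ = D.s * D.g ^ i := by rw [hi]
    _ = D.g ^ i * D.s := ((D.commute_g_s.pow_left i).eq).symm

omit [DecidableEq G] in
/-- **Every element outside `⟨g, s⟩·1 ∪ ⟨g⟩·s·x` … concretely: every element is `gⁱ sʲ` (the abelian part), `gⁱ x` (an involution) or `gⁱ s x`
(square `c`).** [folklore] -/
theorem trichotomy (y : G) : ∃ i : ℕ, i < 2 * n ∧
    ((∃ j : ℕ, j < 2 ∧ y = D.g ^ i * D.s ^ j) ∨ y = D.g ^ i * D.x ∨ y = D.g ^ i * D.s * D.x) := by
  obtain ⟨i, hi, j, hj, e, he, rfl⟩ := D.exhaust y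
  refine ⟨i, hi, ?_⟩
  interval_cases e
  · exact Or.inl ⟨j, hj, by rw [pow_zero, mul_one]⟩
  · interval_cases j
    · exact Or.inr (Or.inl (by rw [pow_zero, mul_one, pow_one]))
    · exact Or.inr (Or.inr (by rw [pow_one, pow_one]))

end Datum

end

end Summit.HodgeConjecture.CorCM.Census.ShearedDihedral
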